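import Summits.CriticalPhenomena.PercolationContinuityZ3.Theorems.FK.SelfDualPointNonPercolation
import Summits.CriticalPhenomena.PercolationContinuityZ3.Theorems.FK.SelfDualPointCriticalUpperBound
import Summits.CriticalPhenomena.PercolationContinuityZ3.Theorems.FK.DLRUniquenessOfEqualTheta
import Summits.CriticalPhenomena.PercolationContinuityZ3.Theorems.FK.DLRUniqueness
import HarnessLib

/-!
# Zhang's argument on `ℤ²`, VI: uniqueness of the random-cluster measure off the self-dual point
# (Grimmett 2006, Thm. (6.17)(b) for the DLR class; Thm. (6.18) with (6.17)(a) discharged)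

Claimed R42 (8)(c) in the cell INBOX at 2026-08-27T21:02:00Z by fkp-10a gen 351 (NEW CLAIM #1 of the gen), addressed to coordinator fk-4 g261 (seated 19:52Z 2026-08-27; records line l.8179) and, if no coordinator is seated, to the lane lead prim-bschramm-lead under provision (ι) (silence = consent); lineage row FO-10a-g351 (self-suggested), package g351-zhang, label ZH-F.
Support file of the `fk-continuity` cell (lineage fkp-10a, `--supports stmt-CriticalPhenomena-4575`); builds on
p205010 (kernel theorem, internal audit signed; external expert review pending).  No definitions, no named facts,
no sorries; standard axioms.  `d = 2`, `q ≥ 1`.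

Direct corollaries of Thm. (6.17)(a) (`SelfDualPointNonPercolation.lean`) for the classes of measures of the lineage:
* `isDLRRandomCluster_and_ae_iff_eq_rcLimit_false_of_ne_selfDual` — **Thm. (6.17)(b) for the DLR class
  `R_{p,q}`**: for `0 < p < 1`, `p ≠ p_sd(q)`, a probability measure on configurations of `ℤ²` is a lattice-carried
  DLR random-cluster measure iff it is `φ⁰_{p,q}` (`|R_{p,q}| = 1`); `IsDLRRandomCluster.eq_rcLimit_false_of_ne_selfDual`;
* `fkGibbs_iff_eq_rcLimit_false_of_ne_selfDual` — the sandwich class `FKGibbs 2 p q` (which contains `φ⁰`, `φ¹`,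
  every DLR state and every weak limit with arbitrary boundary conditions) is `{φ⁰_{p,q}}` for `p ≠ p_sd(q)`;
* `not_exists_isDLRRandomCluster_ne_of_ne_selfDual` — no second DLR state off `p_sd(q)`;
* `rcCriticalProb_eq_selfDual_of_decay` — **Thm. (6.18) with (6.17)(a) discharged**: if (6.19)
  `φ⁰_{p,q}(0 ↔ ∂Λ_n) ≤ A(p)/n` holds for every `p < p_c(q)`, then `p_c(q) = p_sd(q)` (UB-A's
  `rcCriticalProb_eq_selfDual_of_decay_of_le` with its hypothesis `hsd` supplied by `selfDual_le_rcCriticalProb`).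

What is NOT here: (6.19) itself, `p_c(q) ≤ p_sd(q)` unconditionally, the structure of `R_{p_sd(q),q}`.

## References

* G. Grimmett, *The Random-Cluster Model*, Springer 2006, §6.2 Thm. (6.17)(b) ("`|R_{p,q}| = |W_{p,q}| = 1` if
  `p ≠ √q/(1+√q)`") and Thm. (6.18); Thm. (4.34), Thm. (5.33)(a). [Grimmett2006]
* G. Grimmett, *Percolation*, 2nd ed., Springer 1999, §11.3. [GrimmettPercolation1999]
-/

noncomputable section

open scoped Classical Topology
open MeasureTheory Filter Set

namespace Summit.CriticalPhenomena.PercolationContinuityZ3.Theorems.FK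

open Literature.Probability.Percolation Literature.Probability.LatticeModels
  Literature.Barriers.CriticalPhenomena

variable {p q : ℝ} {P : Measure (BondConfig (Site 2))}

/-- **Thm. (6.17)(b) for DLR states**: for `0 < p < 1`, `q ≥ 1`, `p ≠ p_sd(q)`, every lattice-carried DLR
random-cluster measure on `ℤ²` equals `φ⁰_{p,q}` (`θ⁰ = θ¹` off `p_sd(q)` by Thm. (6.17), then Thm. (5.33)(a)).
[cite: Grimmett2006, §6.2 Thm. (6.17)(b)] -/
theorem IsDLRRandomCluster.eq_rcLimit_false_of_ne_selfDual (hP : IsDLRRandomCluster 2 p q P)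
    (hE : ∀ᵐ ω ∂P, ω ⊆ (zdGraph 2).edgeSet) (hp : p ∈ Set.Ioo (0 : ℝ) 1) (hq : 1 ≤ q)
    (hne : p ≠ Real.sqrt q / (1 + Real.sqrt q)) : P = rcLimit 2 false p q :=
  hP.eq_rcLimit_false_of_thetaFree_eq_thetaWired hE hp hq
    (thetaFree_eq_thetaWired_of_ne_selfDual' ⟨hp.1.le, hp.2.le⟩ hq hne)

/-- **`R_{p,q} = {φ⁰_{p,q}}` off the self-dual point** (Grimmett 2006, Thm. (6.17)(b): `|R_{p,q}| = 1` if
`p ≠ √q/(1+√q)`): for `0 < p < 1`, `q ≥ 1`, `p ≠ p_sd(q)`, a measure is a lattice-carried DLR random-cluster measure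
on `ℤ²` iff it is `φ⁰_{p,q}`. [cite: Grimmett2006, §6.2 Thm. (6.17)(b)] -/
theorem isDLRRandomCluster_and_ae_iff_eq_rcLimit_false_of_ne_selfDual (hp : p ∈ Set.Ioo (0 : ℝ) 1) (hq : 1 ≤ q)
    (hne : p ≠ Real.sqrt q / (1 + Real.sqrt q)) :
    (IsDLRRandomCluster 2 p q P ∧ ∀ᵐ ω ∂P, ω ⊆ (zdGraph 2).edgeSet) ↔ P = rcLimit 2 false p q :=
  isDLRRandomCluster_and_ae_iff_eq_rcLimit_false_of_thetaFree_eq_thetaWired hp hq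
    (thetaFree_eq_thetaWired_of_ne_selfDual' ⟨hp.1.le, hp.2.le⟩ hq hne)

/-- No second DLR random-cluster measure on `ℤ²` off the self-dual point (`0 < p < 1`, `q ≥ 1`).
[cite: Grimmett2006, §6.2 Thm. (6.17)(b)] -/
theorem not_exists_isDLRRandomCluster_ne_of_ne_selfDual (hp : p ∈ Set.Ioo (0 : ℝ) 1) (hq : 1 ≤ q)
    (hne : p ≠ Real.sqrt q / (1 + Real.sqrt q)) :
    ¬ ∃ P : Measure (BondConfig (Site 2)), IsDLRRandomCluster 2 p q P ∧ (∀ᵐ ω ∂P, ω ⊆ (zdGraph 2).edgeSet) ∧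
        P ≠ rcLimit 2 false p q := by
  rw [exists_isDLRRandomCluster_ne_rcLimit_false_iff hp hq]
  exact fun h => h (thetaFree_eq_thetaWired_of_ne_selfDual' ⟨hp.1.le, hp.2.le⟩ hq hne)

/-- **The sandwich class is `{φ⁰_{p,q}}` off the self-dual point**: for `0 ≤ p ≤ 1`, `q ≥ 1`, `p ≠ p_sd(q)`, a measure
belongs to `FKGibbs 2 p q` (free/wired/DLR/arbitrary-boundary-condition limits) iff it is `φ⁰_{p,q}`.
[cite: Grimmett2006, §6.2 Thm. (6.17)(b) with Thm. (4.34) (4.36)] -/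
theorem fkGibbs_iff_eq_rcLimit_false_of_ne_selfDual (hp : p ∈ Set.Icc (0 : ℝ) 1) (hq : 1 ≤ q)
    (hne : p ≠ Real.sqrt q / (1 + Real.sqrt q)) : FKGibbs 2 p q P ↔ P = rcLimit 2 false p q :=
  fkGibbs_iff_eq_rcLimit_false_of_thetaFree_eq_thetaWired hp hq (thetaFree_eq_thetaWired_of_ne_selfDual' hp hq hne)

/-- **Grimmett 2006, Thm. (6.18), with (6.17)(a) discharged**: if for every `p < p_c(q)` there is `A(p)` with
`φ⁰_{p,q}(0 ↔ ∂Λ_n) ≤ A(p)/n` for all `n ≥ 1` ((6.19)), then `p_c(q) = p_sd(q) = √q/(1+√q)` (`q ≥ 1`).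
[cite: Grimmett2006, §6.2 Thm. (6.18)] -/
theorem rcCriticalProb_eq_selfDual_of_decay (hq : 1 ≤ q)
    (hdecay : ∀ p : ℝ, p < rcCriticalProb 2 q →
      ∃ A : ℝ, ∀ n : ℕ, 1 ≤ n → (rcLimit 2 false p q).real (siteToBoundary 2 n) ≤ A / n) :
    rcCriticalProb 2 q = Real.sqrt q / (1 + Real.sqrt q) :=
  rcCriticalProb_eq_selfDual_of_decay_of_le hq hdecay (selfDual_le_rcCriticalProb hq)

end Summit.CriticalPhenomena.PercolationContinuityZ3.Theorems.FK

end
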